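import Summits.Ventures.LatticeQCDFlow.Scaling.TaggedHubLumping

/-!
HONEST FRAMING: exact (Metropolis-corrected) sampling algorithms for lattice gauge theory; figures
of merit are autocorrelation/cost numbers at stated couplings and volumes; no continuum-physics
claim.

# TaggedLumpStep — DYNKIN LUMPING PER ATTEMPT COUNT: THE `j`-STEP LAW OF THE CONTENT HUB CHAIN IS THE PUSH-FORWARD OF THE `j`-STEP LAW OF THE TAGGED CHAIN,
# `w_j(w) = x_j(w) + 𝟙{w = s}·x_j(★)` (lean-2 GEN-43, ours)

Venture-side (OURS).  Cell `lqcd-flow` (pub-lqcd), unit `pub-lqcd-lean-2-g43`, 2026-08-31.  Chapter AC, file 15 — the second lemma of the instantiation step of the C2 ∕ C4 assembly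
(memo MEMO-gen43 §3 (g)).  Chapter W file 15 (`TaggedHubLumping`) proved the row identity `P(t,w) + 𝟙{w=s}P(t,★) = K_N(cont t, w)` (`lump_row`) and the lumping of the TAIL RESOLVENT
(`lump_tail`).  The per-attempt bookkeeping (files 8, 10, 14) needs the lumping of the `j`-STEP laws: with `x_0 = δ_z`, `x_{j+1} = x_jP` (the tagged chain, tag content `s`,
`N = N_C + δ_s`) and `w_0 = δ_z`, `w_{j+1} = w_jK_N` (the content hub chain), **`w_j(w) = x_j(w) + 𝟙{w = s}x_j(★)`** for every `j` and `w` — so the lumped law `u^{(j)}` of file 14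
(forward form; the backward form there by C1's `clock_pow_comm`) is exactly the law `u_X` that files 8 and 10 take (`u_X(w) = x_j(w) + 𝟙{w=a}x_j(★)`).

* `tagged_step_absent` (the tagged `j`-step law gives no mass to absent ordinary contents), **`lump_step`**.

Literature grade (cell rule): OWN, plumbing; nothing cited; no new bib keys.
-/

open Finset

namespace Summit.Ventures.LatticeQCDFlow.Scaling

section LumpStep
variable {S : Type*} [Fintype S] [DecidableEq S]
variable {W : S → ℝ} {acc : S → S → ℝ} {K : ℕ} {NC N : S → ℕ} {s : S} {P : Option S → Option S → ℝ} {Kh : S → S → ℝ}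

/-- **The tagged `j`-step law from a present hub gives no mass to absent ordinary contents.** [ours] -/
theorem tagged_step_absent
    (hPoff : ∀ h v, h ≠ v → P (some h) (some v) = if NC h = 0 then 0 else (NC v : ℝ) / K * acc h v)
    (hPout : ∀ v, P none (some v) = (NC v : ℝ) / K * acc s v)
    {z : S} (hz : NC z ≠ 0) {x : ℕ → Option S → ℝ}
    (hx0 : ∀ v, x 0 v = if v = some z then 1 else 0) (hxs : ∀ n v, x (n + 1) v = ∑ h, x n h * P h v) :
    ∀ n w, NC w = 0 → x n (some w) = 0 := by
  intro n
  induction n with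
  | zero =>
      intro w hw
      rw [hx0]
      have : some w ≠ some z := fun e => hz ((Option.some_inj.mp e) ▸ hw)
      rw [if_neg this]
  | succ n ih =>
      intro w hw
      rw [hxs, tagged_sum_option]
      obtain ⟨hnone, hsome⟩ := tagged_absent_col (K := K) hPoff hPout hw
      rw [hnone, mul_zero, zero_add]
      refine sum_eq_zero fun h _ => ?_
      by_cases hhw : h = w
      · rw [hhw, ih w hw, zero_mul]
      · rw [hsome h hhw, mul_zero]

/-- **DYNKIN LUMPING PER ATTEMPT COUNT:** `w_j(w) = x_j(w) + 𝟙{w = s}x_j(★)` for the `j`-step laws of the content hub chain `K_N` (`N = N_C + δ_s`) and of the tagged chain `P`, both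
from a present ordinary hub `z`. [ours] -/
theorem lump_step (hN : N = NC + Pi.single s 1)
    (hPoff : ∀ h v, h ≠ v → P (some h) (some v) = if NC h = 0 then 0 else (NC v : ℝ) / K * acc h v)
    (hPin : ∀ h, P (some h) none = if NC h = 0 then 0 else acc h s / K)
    (hPdiag : ∀ h, P (some h) (some h) = 1 - (∑ v ∈ univ.erase h, P (some h) (some v) + P (some h) none))
    (hPout : ∀ v, P none (some v) = (NC v : ℝ) / K * acc s v) (hPstay : P none none = 1 - ∑ v, P none (some v))
    (hKoff : ∀ h v, h ≠ v → Kh h v = if N h = 0 then 0 else (N v : ℝ) / K * acc h v) (hKdiag : ∀ h, Kh h h = 1 - ∑ v ∈ univ.erase h, Kh h v)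
    {z : S} (hz : NC z ≠ 0) {x : ℕ → Option S → ℝ}
    (hx0 : ∀ v, x 0 v = if v = some z then 1 else 0) (hxs : ∀ n v, x (n + 1) v = ∑ h, x n h * P h v)
    {wl : ℕ → S → ℝ} (hw0 : ∀ v, wl 0 v = if v = z then 1 else 0) (hws : ∀ n v, wl (n + 1) v = ∑ h, wl n h * Kh h v) :
    ∀ n w, wl n w = x n (some w) + (if w = s then x n none else 0) := by
  classical
  have habs := tagged_step_absent (K := K) hPoff hPout hz hx0 hxs
  intro n
  induction n with
  | zero =>
      intro w
      rw [hw0, hx0, hx0]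
      have hns : (none : Option S) ≠ some z := Option.some_ne_none z |>.symm
      rw [if_neg hns]
      by_cases hwz : w = z
      · subst hwz; simp
      · rw [if_neg hwz, if_neg (fun e => hwz (Option.some_inj.mp e))]; simp
  | succ n ih =>
      intro w
      -- left: `Σ_h w_n(h)K(h,w)` with `w_n(h) = x_n(h) + 𝟙{h=s}x_n(★)`; right: `Σ_t x_n(t)[P(t,w) + 𝟙{w=s}P(t,★)] = Σ_t x_n(t)K(cont t, w)`
      rw [hws, hxs, hxs]
      have hright : ∑ t, x n t * P t (some w) + (if w = s then ∑ t, x n t * P t none else 0)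
          = ∑ t, x n t * (P t (some w) + if w = s then P t none else 0) := by
        by_cases hws' : w = s
        · simp only [if_pos hws', ← sum_add_distrib]; exact sum_congr rfl fun t _ => by ring
        · simp only [if_neg hws', add_zero]
      rw [hright, tagged_sum_option]
      -- the ★ row and the present rows lump by `lump_row`; absent rows carry no mass
      have hrow_none := lump_row hN hPoff hPin hPdiag hPout hPstay hKoff hKdiag none (Or.inl rfl) w
      have hrow_some : ∀ h, x n (some h) * (P (some h) (some w) + if w = s then P (some h) none else 0) = x n (some h) * Kh h w := by
        intro h
        by_cases hh : NC h = 0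
        · rw [habs n h hh, zero_mul, zero_mul]
        · have := lump_row hN hPoff hPin hPdiag hPout hPstay hKoff hKdiag (some h) (Or.inr ⟨h, rfl, hh⟩) w
          rw [this]; rfl
      rw [hrow_none, sum_congr rfl fun h _ => hrow_some h]
      simp only [Option.elim]
      -- now both sides are `Σ_h (…)K(h,w) + x_n(★)K(s,w)`
      simp_rw [ih, add_mul, sum_add_distrib]
      rw [show (∑ h, (if h = s then x n none else 0) * Kh h w) = x n none * Kh s w by
        rw [show (∑ h, (if h = s then x n none else 0) * Kh h w) = ∑ h, (if h = s then x n none * Kh h w else 0) from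
          sum_congr rfl fun h _ => by split_ifs <;> simp]
        rw [sum_ite_eq' univ s, if_pos (mem_univ s)]]
      ring

end LumpStep

end Summit.Ventures.LatticeQCDFlow.Scaling
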